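import Summits.QuantumFields.YangMills.Theorems.BalabanUVNodesN11TopChildTStep
import Summits.QuantumFields.YangMills.Theorems.BalabanUVNodesN11SupplyChainFirstLink
import Summits.QuantumFields.YangMills.Theorems.BalabanUVNodesN11AllLargeFieldLabel

/-!
# DAG node N11 — THE (O3′) CLAUSE AT THE TOP CHILD, STAGE-13 LETTERS: at a 𝐓-present child `s′` with `(Ω_{k+1}, Λ_{k+1})(s′) = (𝕋, 𝕋)` of the cured v1.7 record,
# `PresentChildObligations`' 𝐓-image clause IS ONE EXPLICIT IDENTITY IN THE NEW FIELD; at `k = 0` it is [I] Thm 1 + [II] verbatim-shaped: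
# `∫dU δ(ŪV′⁻¹) [χ′_0(ALL cubes)(U,V′) · Σ_S ζ_1(∅,∅,(∅,S))(U,V′) · ρ₀(U)] (V′) = ζ_0(∅)·χ(∅,∅)·e^{−½quad_0(𝕋)} (base₁ V′) · exp A_1(𝕋,𝕋; 𝐄^{(1)}, 𝐑^{(1)}, 𝐁^{(1)}, E₁)(U_1(V′))`
# for a.e. `V′` all of whose χ₁-cubes are (3.2)-small

HEADER — WORK-UNIT METADATA.  Cell `pub-ymgap`, YM-PLAN Track A (HUMAN RULING D-0062), seat `pub-ymgap-dag-n11-d` (g18; N11 [B14], s2), route `BalabanUVNodes`, item K1⁹ =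
stmt-QuantumFields-27364 (helper lane, `--kind proof --supports 27364 --as helper`, count-neutral).  [III] = [Balaban1988Convergent], [I] = [Balaban1987RG1], [II] = [Balaban1988RG2Cluster].
Over this seat's g18 `…N11TopChildStepWeight` (the step weight of record at the top child) and `…N11TopChildTStep` (11a's `𝐓` and def-T's slots there; ★★★ `O3_top_iff`), dag-n11-e's
`…N11Sect3SupplyChainDefs` (`PresentChildObligations`), dag-n08-w2's `…N11SupplyChainFirstLink` (`FirstStepClausesAt`, `presentChildObligations_zero_iff`) ∕ `…N11FirstStepSupply`
(`slotsOfRecord₁₃H_zero_eq_rhoZero`), dag-n11-e's `…N11AllLargeFieldLabel.sideD_pos` (`0 < sideD` from `1 ≤ M`).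

WHY THIS FILE.  The -d lane's target is N11's (S1ᵀ)₁₃ = the 𝐓-image clause (O3′) at every 𝐓-present expansion child.  g10–g17 typed its general form (per old branch and a.e.
frozen retained configuration, ONE one-fibre conditional-expectation identity).  The MAIN child — the top pair `(𝕋, 𝕋)` over the all-small history, [IV] (0.2)'s small-field term —
needs none of that: by `…N11TopChildTStep` both members of (O3′) are explicit there.  This file writes the clause at the Stage-13 letters of the cured record (`Stage13HParams`, `WtOfRecord₁₃H`,
`UbgOfRecord₁₃CoP`, `settingOfRecord₁₃`, `θ.rzAt`), for every level and — with `ρ₀`, `χ₀ ≡ 1` — at the first step, where it is [I] Thm 1 + [II] as the tree needs it: ONE a.e.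
identity between def-T's one-step transport of `χ′_0(ALL)·Σ_S ζ_1·ρ₀` and `ζ_0 w_0 · exp A_1` evaluated at the background of record.  Nothing is frozen, nothing is summed over `Y`,
no fluctuation variable is kept, no chart is needed to STATE it (the chart is how one PROVES it: [I] §2 + [15] Sect. C + [II]).

WHAT THIS FILE PROVES (0 `def`, 0 `sorry`, standard axioms).  §1 every level: ★★★ `O3_top_iff_at_record₁₃` (the (O3′)-shaped clause at the top child of the Stage-13 record ↔ the
explicit identity) · ★★★ `presentChild_O3_top_of_identity` (the (O3′) conjunct of `PresentChildObligations θ p k t tnew EkN s′` at the top child FROM the explicit identity for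
`(graftAboveB k (t s′.init) (tnew s′), EkN s′)`).  §2 the first step: ★★★ `firstStep_O3_top_iff` ((iii) of `FirstStepClausesAt θ p s′ u₁ e₁` at the top pair ↔ [I] Thm 1 + [II]'s
identity, letters open: old side `χ′_0(ALL)(U,V′)·Σ_S ζ_1(∅,∅,(∅,S))(U,V′)·ρ₀(U)` transported, new side `ζ_0(∅)(base₁V′)·w_0(𝕋,∅,∅)(base₁V′)·exp A_1(s′; u₁,(∅,0),e₁)(U_1(base₁V′))`) ·
★★★ `firstStepClausesAt_top_of_identity` ∕ `presentChildObligations_zero_top_of_identity` (the first-step matrix ∕ dag-n11-e's obligations at the top pair from (i)+(ii) + the identity) ·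
`exists_top_pair` (the top pair IS a history of length 1 of the record: `σOfRecord s₀ (∅,∅,(∅,∅))`, `1 ≤ M`).

HONEST FRAMING.  Helper lane of K1⁹; count-neutral; compositions BY NAME over this seat's two g18 files; the identity is DISPLAYED (as a hypothesis ∕ one side of an `↔`) — it IS
[I] Thm 1 + [II] ([III] Thm 2 at the main term), NOT proved; nothing of Bałaban asserted; the new terms `(u₁, e₁)` ∕ `(tnew, EkN)` and their bounds (O1′)+(O2) are the supplier's;
N11 NOT discharged; K1⁹ NOT closed, no registered stub touched; counts unmoved (typed 28∕28 · discharged 5∕27 · A 5∕28).  One finite `𝕋⁴_{L^K}` programme at fixed `ε = L^{−K}` —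
NOT ℝ⁴, NOT OS, NOT a mass gap, NOT Clay.  No `sorry`, `axiom`, `def`, `instance`, `notation`.  Sources (SHAPE only): [III] Thm 1 p.262, Thm 2 p.263, (2.18) p.257, (2.22)–(2.23)
p.258, (3.1) p.264, (3.2)–(3.5) p.265, (3.24)–(3.25) p.270, §3 p.279; [I] Thm 1 p.259, (0.4) p.253, §2 p.267; [IV] = [Balaban1989LargeFieldI] (0.2) p.176.
-/

noncomputable section

open MeasureTheory
open scoped BigOperators Matrix.Norms.L2Operator

namespace Summit.QuantumFields.YangMills.Theorems.BalabanUVNodesN11TopChildO3AtRecord13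

open Literature.MathematicalPhysics.QuantumFieldTheory.Balaban1983to89 T4Continuum Node00 Node00.Tk B14.Eq218Concrete B14.Sect3Decomp
open BalabanUVNodesN11Sect3SupplySpliceOwnBoundary (graftAboveB)
open BalabanUVNodesN11Sect3SupplyChainDefs (PresentChildObligations)
open BalabanUVNodesN11SupplyChainFirstLink (FirstStepClausesAt presentChildObligations_zero_iff)
open BalabanUVNodesN11FirstStepSupply (slotsOfRecord₁₃H_zero_eq_rhoZero)
open BalabanUVNodesN11AllLargeFieldLabel (sideD_pos)
open BalabanUVNodesN11TopChildStepWeight (σOfRecord_zero_empty_top)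
open BalabanUVNodesN11TopChildTStep (O3_top_iff slotsTOfRecord_succ_top_eq_of_chiSeq_ne_zero sect2Slot_top_eq_exp)

variable {F : T4Family} {N : ℕ} [NeZero N]

/-! ## §1. Every level: the (O3′) clause at the top child of the Stage-13 record -/

section EveryLevel

variable (θ : Stage13HParams F N) (p : B12.RunParams)

/-- ★★★ **THE (O3′)-SHAPED CLAUSE AT THE TOP CHILD OF THE STAGE-13 RECORD IS ONE EXPLICIT IDENTITY** (`1 ≤ M`; any term values `t′`, constant `E′`): for a history `s′` of
length `k+1` with `(Ω_{k+1}, Λ_{k+1})(s′) = (𝕋, 𝕋)`,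
«`slotT_{k+1}(s′) = 0 ∨ ∀ᵐ V′, χ_{k+1}(s′)(V′) ≠ 0 → slotT_{k+1}(s′)(V′) = sect2Slot(W(s′), s′, t′, E′, U_{k+1})(V′)`» `↔`
«`slotT_{k+1}(s′) = 0 ∨ ∀ᵐ V′, χ_{k+1}(s′)(V′) ≠ 0 → ∫dU δ(ŪV′⁻¹)[χ′_k(ALL)(U,V′)·Σ_S ζ_{k+1}(∅,∅,(∅,S))(U,V′)·χ_k(init s′) slot_k(init s′)(U)](V′) = (Π_{j≤k} ζ_j(∅)·w_j(𝕋,∅,∅))(base V′)·exp A_{k+1}(s′;t′,(∅,0),E′)(U_{k+1}(base V′))`».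
[cite: Balaban1988Convergent, Thm 1 p.262, Thm 2 p.263, (3.1) p.264, (3.24)–(3.25) p.270, (2.18) p.257, (2.22)–(2.23) p.258; Balaban1987RG1, Thm 1 p.259] -/
theorem O3_top_iff_at_record₁₃ (hM : 1 ≤ θ.τ9.M) {k : ℕ} (s' : SeqOfRecord F θ.ν θ.τ9.M (gOfRecord₁₃ F N θ.toStage13Params p) p.K (k + 1))
    (hΩ : s'.Ω (k + 1) = Set.univ) (hΛ : s'.Λ (k + 1) = Set.univ) (t' : Sect2.TermValues (F.P p.K) (MatA N) (FluctV N) θ.τ9.M) (E' : ℝ) :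
    (slotsTOfRecord F N θ.ν θ.τ9 (EOfRecord₁₃ F N θ.toStage13Params) (wOfRecord₉ F N θ.toStage9Params) θ.ppSel p (gOfRecord₁₃ F N θ.toStage13Params p) (k + 1) s' = 0 ∨
      ∀ᵐ V' ∂fieldMeasure (F.P p.K) (k + 1) (SU N),
        chiSeqOfRecord F N θ.ν θ.τ9.M (gOfRecord₁₃ F N θ.toStage13Params p) p.K (k + 1) s' V' ≠ 0 →
          slotsTOfRecord F N θ.ν θ.τ9 (EOfRecord₁₃ F N θ.toStage13Params) (wOfRecord₉ F N θ.toStage9Params) θ.ppSel p (gOfRecord₁₃ F N θ.toStage13Params p) (k + 1) s' V' =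
            sect2Slot F N (FluctV N) p.K (settingOfRecord₁₃ F N θ.toStage13Params p) (θ.rzAt p s') (WtOfRecord₁₃H F N θ p s') s' t' E'
              (UbgOfRecord₁₃CoP F N θ.toStage13Params p (k + 1) s') V') ↔
    (slotsTOfRecord F N θ.ν θ.τ9 (EOfRecord₁₃ F N θ.toStage13Params) (wOfRecord₉ F N θ.toStage9Params) θ.ppSel p (gOfRecord₁₃ F N θ.toStage13Params p) (k + 1) s' = 0 ∨
      ∀ᵐ V' ∂fieldMeasure (F.P p.K) (k + 1) (SU N),
        chiSeqOfRecord F N θ.ν θ.τ9.M (gOfRecord₁₃ F N θ.toStage13Params p) p.K (k + 1) s' V' ≠ 0 →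
          transportOfRecord F N p.K k (fun U =>
              chiPrime (sect3DataOfRecord F N θ.ν θ.τ9.M p (gOfRecord₁₃ F N θ.toStage13Params p) k s'.init) (avOfRecord F N p.K)
                  (2 * deltaOfRecord θ.ν (gOfRecord₁₃ F N θ.toStage13Params p) k θ.A₁) (Finset.univ : Finset (Iχ F θ.ν p (gOfRecord₁₃ F N θ.toStage13Params p) k)) U V' *
                (∑ S : Finset (Iχ F θ.ν p (gOfRecord₁₃ F N θ.toStage13Params p) k), θ.ζ p (gOfRecord₁₃ F N θ.toStage13Params p) k s'.init ∅ ∅ (∅, S) U V') *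
                (chiSeqOfRecord F N θ.ν θ.τ9.M (gOfRecord₁₃ F N θ.toStage13Params p) p.K k s'.init U *
                  slotsOfRecord F N θ.ν θ.τ9 (EOfRecord₁₃ F N θ.toStage13Params) (wOfRecord₉ F N θ.toStage9Params) θ.ppSel p (gOfRecord₁₃ F N θ.toStage13Params p) k s'.init U)) V' =
            (∏ j ∈ Finset.range (k + 1), (WtOfRecord₁₃H F N θ p s').ζ j ∅ (baseCfg (k + 1) V') * (WtOfRecord₁₃H F N θ p s').w j Set.univ ∅ ∅ (baseCfg (k + 1) V')) *
              Real.exp ((sect2ActionDataOfRecord F N (FluctV N) p.K (settingOfRecord₁₃ F N θ.toStage13Params p) (θ.rzAt p s') s' t' (fun _ => ∅, fun _ => 0) E').action23 (k + 1)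
                (UbgOfRecord₁₃CoP F N θ.toStage13Params p (k + 1) s' (fun j => ((baseCfg (V := FluctV N) (k + 1) V') j).1)))) :=
  O3_top_iff F N θ.ν θ.τ9 (EOfRecord₁₃ F N θ.toStage13Params) θ.A₁ θ.ζ θ.ppSel p (gOfRecord₁₃ F N θ.toStage13Params p) k
    (settingOfRecord₁₃ F N θ.toStage13Params p) (θ.rzAt p s') (WtOfRecord₁₃H F N θ p s') (sideD_pos θ.ν hM p _ k) s' hΩ hΛ t' E' _

/-- ★★★ **THE (O3′) CONJUNCT OF `PresentChildObligations` AT THE TOP CHILD FROM THE EXPLICIT IDENTITY**: for a level-`k` witness `t`, the supplier's response `(tnew, EkN)` and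
a history `s′` with `(Ω_{k+1}, Λ_{k+1})(s′) = (𝕋, 𝕋)`, the 𝐓-image clause for the spliced terms `graftAboveB k (t (init s′)) (tnew s′)` with the constant `EkN s′` holds as soon
as EITHER `slotT_{k+1}(s′) ≡ 0` OR the explicit identity holds a.e. on the `χ_{k+1}`-support. [cite: Balaban1988Convergent, Thm 2 p.263, §3 p.279, (3.24)–(3.25) p.270, (2.18) p.257; Balaban1987RG1, Thm 1 p.259] -/
theorem presentChild_O3_top_of_identity (hM : 1 ≤ θ.τ9.M) {k : ℕ}
    (t : SeqOfRecord F θ.ν θ.τ9.M (gOfRecord₁₃ F N θ.toStage13Params p) p.K k → Sect2.TermValues (F.P p.K) (MatA N) (FluctV N) θ.τ9.M)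
    (tnew : SeqOfRecord F θ.ν θ.τ9.M (gOfRecord₁₃ F N θ.toStage13Params p) p.K (k + 1) → Sect2.TermValues (F.P p.K) (MatA N) (FluctV N) θ.τ9.M)
    (EkN : SeqOfRecord F θ.ν θ.τ9.M (gOfRecord₁₃ F N θ.toStage13Params p) p.K (k + 1) → ℝ)
    (s' : SeqOfRecord F θ.ν θ.τ9.M (gOfRecord₁₃ F N θ.toStage13Params p) p.K (k + 1)) (hΩ : s'.Ω (k + 1) = Set.univ) (hΛ : s'.Λ (k + 1) = Set.univ)
    (hT : slotsTOfRecord F N θ.ν θ.τ9 (EOfRecord₁₃ F N θ.toStage13Params) (wOfRecord₉ F N θ.toStage9Params) θ.ppSel p (gOfRecord₁₃ F N θ.toStage13Params p) (k + 1) s' = 0 ∨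
      ∀ᵐ V' ∂fieldMeasure (F.P p.K) (k + 1) (SU N),
        chiSeqOfRecord F N θ.ν θ.τ9.M (gOfRecord₁₃ F N θ.toStage13Params p) p.K (k + 1) s' V' ≠ 0 →
          transportOfRecord F N p.K k (fun U =>
              chiPrime (sect3DataOfRecord F N θ.ν θ.τ9.M p (gOfRecord₁₃ F N θ.toStage13Params p) k s'.init) (avOfRecord F N p.K)
                  (2 * deltaOfRecord θ.ν (gOfRecord₁₃ F N θ.toStage13Params p) k θ.A₁) (Finset.univ : Finset (Iχ F θ.ν p (gOfRecord₁₃ F N θ.toStage13Params p) k)) U V' *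
                (∑ S : Finset (Iχ F θ.ν p (gOfRecord₁₃ F N θ.toStage13Params p) k), θ.ζ p (gOfRecord₁₃ F N θ.toStage13Params p) k s'.init ∅ ∅ (∅, S) U V') *
                (chiSeqOfRecord F N θ.ν θ.τ9.M (gOfRecord₁₃ F N θ.toStage13Params p) p.K k s'.init U *
                  slotsOfRecord F N θ.ν θ.τ9 (EOfRecord₁₃ F N θ.toStage13Params) (wOfRecord₉ F N θ.toStage9Params) θ.ppSel p (gOfRecord₁₃ F N θ.toStage13Params p) k s'.init U)) V' =
            (∏ j ∈ Finset.range (k + 1), (WtOfRecord₁₃H F N θ p s').ζ j ∅ (baseCfg (k + 1) V') * (WtOfRecord₁₃H F N θ p s').w j Set.univ ∅ ∅ (baseCfg (k + 1) V')) *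
              Real.exp ((sect2ActionDataOfRecord F N (FluctV N) p.K (settingOfRecord₁₃ F N θ.toStage13Params p) (θ.rzAt p s') s'
                  (graftAboveB k (t s'.init) (tnew s')) (fun _ => ∅, fun _ => 0) (EkN s')).action23 (k + 1)
                (UbgOfRecord₁₃CoP F N θ.toStage13Params p (k + 1) s' (fun j => ((baseCfg (V := FluctV N) (k + 1) V') j).1)))) :
    slotsTOfRecord F N θ.ν θ.τ9 (EOfRecord₁₃ F N θ.toStage13Params) (wOfRecord₉ F N θ.toStage9Params) θ.ppSel p (gOfRecord₁₃ F N θ.toStage13Params p) (k + 1) s' = 0 ∨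
      ∀ᵐ V' ∂fieldMeasure (F.P p.K) (k + 1) (SU N),
        chiSeqOfRecord F N θ.ν θ.τ9.M (gOfRecord₁₃ F N θ.toStage13Params p) p.K (k + 1) s' V' ≠ 0 →
          slotsTOfRecord F N θ.ν θ.τ9 (EOfRecord₁₃ F N θ.toStage13Params) (wOfRecord₉ F N θ.toStage9Params) θ.ppSel p (gOfRecord₁₃ F N θ.toStage13Params p) (k + 1) s' V' =
            sect2Slot F N (FluctV N) p.K (settingOfRecord₁₃ F N θ.toStage13Params p) (θ.rzAt p s') (WtOfRecord₁₃H F N θ p s') s'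
              (graftAboveB k (t s'.init) (tnew s')) (EkN s') (UbgOfRecord₁₃CoP F N θ.toStage13Params p (k + 1) s') V' :=
  (O3_top_iff_at_record₁₃ θ p hM s' hΩ hΛ _ _).2 hT

end EveryLevel

/-! ## §2. The first step: [I] Thm 1 + [II] at the top pair `(Ω₁, Λ₁) = (𝕋, 𝕋)`, letters open -/

section FirstStep

variable (θ : Stage13HParams F N) (p : B12.RunParams)

/-- **THE TOP PAIR EXISTS** as a history of length `1` of the record (`1 ≤ M`): the label `(∅, ∅, (∅, ∅))` over the empty history is mapped to `(𝕋, 𝕋)`.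
[cite: Balaban1988Convergent, (3.5) p.265, (3.20) p.269, (2.1) p.254] -/
theorem exists_top_pair (hM : 1 ≤ θ.τ9.M) (s₀ : SeqOfRecord F θ.ν θ.τ9.M (gOfRecord₁₃ F N θ.toStage13Params p) p.K 0) :
    ∃ s' : SeqOfRecord F θ.ν θ.τ9.M (gOfRecord₁₃ F N θ.toStage13Params p) p.K 1, s'.init = s₀ ∧ s'.Ω 1 = Set.univ ∧ s'.Λ 1 = Set.univ := by
  classical
  refine ⟨σOfRecord F θ.ν θ.τ9.M p (gOfRecord₁₃ F N θ.toStage13Params p) 0 s₀ (∅, ∅, (∅, ∅)), init_σOfRecord F θ.ν θ.τ9.M p _ 0 s₀ _, ?_⟩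
  exact σOfRecord_zero_empty_top F θ.ν θ.τ9.M p (gOfRecord₁₃ F N θ.toStage13Params p) (sideD_pos θ.ν hM p _ 0) s₀ ∅

/-- ★★★ **[I] THM 1 + [II] AT THE TOP PAIR, AS THE TREE NEEDS IT.**  For a history `s′ = (Ω₁, Λ₁) = (𝕋, 𝕋)` of the Stage-13 record (`1 ≤ M`) and first-step term values ∕ constant
`(u₁, e₁)`, clause (iii) of dag-n08-w2's `FirstStepClausesAt θ p s′ u₁ e₁` — «`𝐓ρ₀(s′) ≡ 0 ∨ 𝐓ρ₀(s′) = 𝐓₁(s′)[W(s′)] exp A₁(s′)[u₁, e₁]` a.e. on the `χ₁(s′)`-support» — IS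
«`𝐓ρ₀(s′) ≡ 0 ∨` for `dV′`-a.e. `V′` with every χ₁-cube (3.2)-small:
`∫dU δ(ŪV′⁻¹) [χ′_0(ALL cubes)(U,V′) · Σ_S ζ_1(∅,∅,(∅,S))(U,V′) · ρ₀(U)] (V′) = ζ_0(∅)(base₁V′) · w_0(𝕋,∅,∅)(base₁V′) · exp A_1(s′; u₁, (∅,0), e₁)(U_1(base₁ V′))`»,
where `ρ₀ = e^{−E(p)} exp(−A∕g₀²)` (`rhoZeroOfRecord`), `χ′_0` = def-R's pinned (3.3) indicators (`U` bondwise `2δ_0`-close to `U_{1,□′}(V′)` on every `(□′^{∼2})*`), `ζ_1` = the step's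
residual fluctuation factor, `ζ_0 ∕ w_0 = χ(∅,∅)e^{−½quad_0(𝕋)}` = 11a's generation weights of the cured record's `W(s′)`, `exp A_1` = 11c's operand.  The old field is integrated ONCE along
Bałaban's averaging; nothing is frozen, no `Y`-sum, no kept fluctuation variable. [cite: Balaban1987RG1, Thm 1 p.259, (0.4) p.253, §2 p.267; Balaban1988Convergent, Thm 1 p.262, (3.1) p.264, (3.2)–(3.5) p.265, (3.25) p.270, (2.22)–(2.23) p.258] -/
theorem firstStep_O3_top_iff (hM : 1 ≤ θ.τ9.M) (s' : SeqOfRecord F θ.ν θ.τ9.M (gOfRecord₁₃ F N θ.toStage13Params p) p.K 1)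
    (hΩ : s'.Ω 1 = Set.univ) (hΛ : s'.Λ 1 = Set.univ) (u₁ : Sect2.TermValues (F.P p.K) (MatA N) (FluctV N) θ.τ9.M) (e₁ : ℝ) :
    (slotsTOfRecord F N θ.ν θ.τ9 (EOfRecord₁₃ F N θ.toStage13Params) (wOfRecord₉ F N θ.toStage9Params) θ.ppSel p (gOfRecord₁₃ F N θ.toStage13Params p) 1 s' = 0 ∨
      ∀ᵐ V' ∂fieldMeasure (F.P p.K) 1 (SU N),
        chiSeqOfRecord F N θ.ν θ.τ9.M (gOfRecord₁₃ F N θ.toStage13Params p) p.K 1 s' V' ≠ 0 →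
          slotsTOfRecord F N θ.ν θ.τ9 (EOfRecord₁₃ F N θ.toStage13Params) (wOfRecord₉ F N θ.toStage9Params) θ.ppSel p (gOfRecord₁₃ F N θ.toStage13Params p) 1 s' V' =
            sect2Slot F N (FluctV N) p.K (settingOfRecord₁₃ F N θ.toStage13Params p) (θ.rzAt p s') (WtOfRecord₁₃H F N θ p s') s' u₁ e₁
              (UbgOfRecord₁₃CoP F N θ.toStage13Params p 1 s') V') ↔
    (slotsTOfRecord F N θ.ν θ.τ9 (EOfRecord₁₃ F N θ.toStage13Params) (wOfRecord₉ F N θ.toStage9Params) θ.ppSel p (gOfRecord₁₃ F N θ.toStage13Params p) 1 s' = 0 ∨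
      ∀ᵐ V' ∂fieldMeasure (F.P p.K) 1 (SU N),
        chiSeqOfRecord F N θ.ν θ.τ9.M (gOfRecord₁₃ F N θ.toStage13Params p) p.K 1 s' V' ≠ 0 →
          transportOfRecord F N p.K 0 (fun U =>
              chiPrime (sect3DataOfRecord F N θ.ν θ.τ9.M p (gOfRecord₁₃ F N θ.toStage13Params p) 0 s'.init) (avOfRecord F N p.K)
                  (2 * deltaOfRecord θ.ν (gOfRecord₁₃ F N θ.toStage13Params p) 0 θ.A₁) (Finset.univ : Finset (Iχ F θ.ν p (gOfRecord₁₃ F N θ.toStage13Params p) 0)) U V' *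
                (∑ S : Finset (Iχ F θ.ν p (gOfRecord₁₃ F N θ.toStage13Params p) 0), θ.ζ p (gOfRecord₁₃ F N θ.toStage13Params p) 0 s'.init ∅ ∅ (∅, S) U V') *
                rhoZeroOfRecord F N p.K (gOfRecord₁₃ F N θ.toStage13Params p 0) (EOfRecord₁₃ F N θ.toStage13Params p) U) V' =
            (WtOfRecord₁₃H F N θ p s').ζ 0 ∅ (baseCfg 1 V') * (WtOfRecord₁₃H F N θ p s').w 0 Set.univ ∅ ∅ (baseCfg 1 V') *
              Real.exp ((sect2ActionDataOfRecord F N (FluctV N) p.K (settingOfRecord₁₃ F N θ.toStage13Params p) (θ.rzAt p s') s' u₁ (fun _ => ∅, fun _ => 0) e₁).action23 1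
                (UbgOfRecord₁₃CoP F N θ.toStage13Params p 1 s' (fun j => ((baseCfg (V := FluctV N) 1 V') j).1)))) := by
  have hD := sideD_pos (F := F) θ.ν hM p (gOfRecord₁₃ F N θ.toStage13Params p) 0
  refine or_congr_right (Filter.eventually_congr (Filter.Eventually.of_forall fun V' => ?_))
  refine imp_congr_right fun hχ => ?_
  have hfun : (fun U => chiPrime (sect3DataOfRecord F N θ.ν θ.τ9.M p (gOfRecord₁₃ F N θ.toStage13Params p) 0 s'.init) (avOfRecord F N p.K)
          (2 * deltaOfRecord θ.ν (gOfRecord₁₃ F N θ.toStage13Params p) 0 θ.A₁) (Finset.univ : Finset (Iχ F θ.ν p (gOfRecord₁₃ F N θ.toStage13Params p) 0)) U V' *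
        (∑ S : Finset (Iχ F θ.ν p (gOfRecord₁₃ F N θ.toStage13Params p) 0), θ.ζ p (gOfRecord₁₃ F N θ.toStage13Params p) 0 s'.init ∅ ∅ (∅, S) U V') *
        (chiSeqOfRecord F N θ.ν θ.τ9.M (gOfRecord₁₃ F N θ.toStage13Params p) p.K 0 s'.init U *
          slotsOfRecord F N θ.ν θ.τ9 (EOfRecord₁₃ F N θ.toStage13Params) (wOfRecord₉ F N θ.toStage9Params) θ.ppSel p (gOfRecord₁₃ F N θ.toStage13Params p) 0 s'.init U)) =
      fun U => chiPrime (sect3DataOfRecord F N θ.ν θ.τ9.M p (gOfRecord₁₃ F N θ.toStage13Params p) 0 s'.init) (avOfRecord F N p.K)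
          (2 * deltaOfRecord θ.ν (gOfRecord₁₃ F N θ.toStage13Params p) 0 θ.A₁) (Finset.univ : Finset (Iχ F θ.ν p (gOfRecord₁₃ F N θ.toStage13Params p) 0)) U V' *
        (∑ S : Finset (Iχ F θ.ν p (gOfRecord₁₃ F N θ.toStage13Params p) 0), θ.ζ p (gOfRecord₁₃ F N θ.toStage13Params p) 0 s'.init ∅ ∅ (∅, S) U V') *
        rhoZeroOfRecord F N p.K (gOfRecord₁₃ F N θ.toStage13Params p 0) (EOfRecord₁₃ F N θ.toStage13Params p) U := by
    funext U
    rw [chiSeqOfRecord_zero, one_mul, slotsOfRecord₁₃H_zero_eq_rhoZero]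
  rw [slotsTOfRecord_succ_top_eq_of_chiSeq_ne_zero F N θ.ν θ.τ9 (EOfRecord₁₃ F N θ.toStage13Params) θ.A₁ θ.ζ θ.ppSel p (gOfRecord₁₃ F N θ.toStage13Params p) 0 hD s' hΩ hΛ V' hχ,
    sect2Slot_top_eq_exp (FluctV N) p.K (settingOfRecord₁₃ F N θ.toStage13Params p) (θ.rzAt p s') (WtOfRecord₁₃H F N θ p s') s' hΩ hΛ u₁ e₁ _ V', hfun, Finset.prod_range_one]

/-- ★★★ **THE FIRST-STEP MATRIX AT THE TOP PAIR FROM (i)+(ii) AND THE EXPLICIT IDENTITY**: dag-n08-w2's `FirstStepClausesAt θ p s′ u₁ e₁` at `s′ = (𝕋, 𝕋)` from r11's new-term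
obligations (i), the analyticity rows (ii), and [I] Thm 1 + [II]'s identity in the explicit form of `firstStep_O3_top_iff`. [cite: Balaban1988Convergent, Thm 2 p.263, §3 p.279, (3.25) p.270, (2.27)–(2.31) pp.259–260; Balaban1987RG1, Thm 1 p.259] -/
theorem firstStepClausesAt_top_of_identity (hM : 1 ≤ θ.τ9.M) (s' : SeqOfRecord F θ.ν θ.τ9.M (gOfRecord₁₃ F N θ.toStage13Params p) p.K 1)
    (hΩ : s'.Ω 1 = Set.univ) (hΛ : s'.Λ 1 = Set.univ) (u₁ : Sect2.TermValues (F.P p.K) (MatA N) (FluctV N) θ.τ9.M) (e₁ : ℝ)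
    (hnew : Step.LFNewTerms (sect2TowerOfRecord F N (FluctV N) p.K (settingOfRecord₁₃ F N θ.toStage13Params p) (θ.rzAt p s') s' u₁)
      (settingOfRecord₁₃ F N θ.toStage13Params p).lf (settingOfRecord₁₃ F N θ.toStage13Params p).βc 0)
    (hanE : ∀ (X : (Sect2.domSys (F.P p.K) θ.τ9.M 1).Dom) (z : Site (F.P p.K) 1) (g : ℝ), 0 ≤ g → g ≤ (settingOfRecord₁₃ F N θ.toStage13Params p).lf.γ →
      AnalyticOnNhd ℂ (u₁.E 1 X z g)
        ((sect2TowerOfRecord F N (FluctV N) p.K (settingOfRecord₁₃ F N θ.toStage13Params p) (θ.rzAt p s') s' u₁).space 1 X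
          ((settingOfRecord₁₃ F N θ.toStage13Params p).lf.alpha0 ((settingOfRecord₁₃ F N θ.toStage13Params p).flow.g 1))
          ((settingOfRecord₁₃ F N θ.toStage13Params p).lf.alpha1 ((settingOfRecord₁₃ F N θ.toStage13Params p).flow.g 1))))
    (hanR : ∀ X : (Sect2.domSys (F.P p.K) θ.τ9.M 1).Dom,
      AnalyticOnNhd ℂ (u₁.R 1 X)
        ((sect2TowerOfRecord F N (FluctV N) p.K (settingOfRecord₁₃ F N θ.toStage13Params p) (θ.rzAt p s') s' u₁).space 1 X
          ((settingOfRecord₁₃ F N θ.toStage13Params p).lf.alpha0 ((settingOfRecord₁₃ F N θ.toStage13Params p).flow.g 1))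
          ((settingOfRecord₁₃ F N θ.toStage13Params p).lf.alpha1 ((settingOfRecord₁₃ F N θ.toStage13Params p).flow.g 1))))
    (hanB : ∀ (X : (Sect2.domSys (F.P p.K) θ.τ9.M 1).Dom) (a : SFluct (F.P p.K) (FluctV N)),
      AnalyticOnNhd ℂ (fun φ => u₁.B 1 X φ a)
        ((sect2TowerOfRecord F N (FluctV N) p.K (settingOfRecord₁₃ F N θ.toStage13Params p) (θ.rzAt p s') s' u₁).spaceB 1 X))
    (hT : slotsTOfRecord F N θ.ν θ.τ9 (EOfRecord₁₃ F N θ.toStage13Params) (wOfRecord₉ F N θ.toStage9Params) θ.ppSel p (gOfRecord₁₃ F N θ.toStage13Params p) 1 s' = 0 ∨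
      ∀ᵐ V' ∂fieldMeasure (F.P p.K) 1 (SU N),
        chiSeqOfRecord F N θ.ν θ.τ9.M (gOfRecord₁₃ F N θ.toStage13Params p) p.K 1 s' V' ≠ 0 →
          transportOfRecord F N p.K 0 (fun U =>
              chiPrime (sect3DataOfRecord F N θ.ν θ.τ9.M p (gOfRecord₁₃ F N θ.toStage13Params p) 0 s'.init) (avOfRecord F N p.K)
                  (2 * deltaOfRecord θ.ν (gOfRecord₁₃ F N θ.toStage13Params p) 0 θ.A₁) (Finset.univ : Finset (Iχ F θ.ν p (gOfRecord₁₃ F N θ.toStage13Params p) 0)) U V' *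
                (∑ S : Finset (Iχ F θ.ν p (gOfRecord₁₃ F N θ.toStage13Params p) 0), θ.ζ p (gOfRecord₁₃ F N θ.toStage13Params p) 0 s'.init ∅ ∅ (∅, S) U V') *
                rhoZeroOfRecord F N p.K (gOfRecord₁₃ F N θ.toStage13Params p 0) (EOfRecord₁₃ F N θ.toStage13Params p) U) V' =
            (WtOfRecord₁₃H F N θ p s').ζ 0 ∅ (baseCfg 1 V') * (WtOfRecord₁₃H F N θ p s').w 0 Set.univ ∅ ∅ (baseCfg 1 V') *
              Real.exp ((sect2ActionDataOfRecord F N (FluctV N) p.K (settingOfRecord₁₃ F N θ.toStage13Params p) (θ.rzAt p s') s' u₁ (fun _ => ∅, fun _ => 0) e₁).action23 1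
                (UbgOfRecord₁₃CoP F N θ.toStage13Params p 1 s' (fun j => ((baseCfg (V := FluctV N) 1 V') j).1)))) :
    FirstStepClausesAt θ p s' u₁ e₁ :=
  ⟨hnew, hanE, hanR, hanB, (firstStep_O3_top_iff θ p hM s' hΩ hΛ u₁ e₁).2 hT⟩

/-- ★★★ **dag-n11-e's OBLIGATIONS AT THE TOP PAIR, FIRST STEP**: for EVERY level-`0` witness `t` (not read at `k = 0`), `PresentChildObligations θ p 0 t tnew EkN s′` at `s′ = (𝕋, 𝕋)` from
(i)+(ii) for `(tnew s′, EkN s′)` and the explicit identity — `presentChildObligations_zero_iff` over `firstStepClausesAt_top_of_identity`.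
[cite: Balaban1988Convergent, Thm 2 p.263, §3 p.279, (3.24)–(3.25) p.270, (2.27)–(2.31) pp.259–260; Balaban1987RG1, Thm 1 p.259] -/
theorem presentChildObligations_zero_top_of_identity (hM : 1 ≤ θ.τ9.M)
    (t : SeqOfRecord F θ.ν θ.τ9.M (gOfRecord₁₃ F N θ.toStage13Params p) p.K 0 → Sect2.TermValues (F.P p.K) (MatA N) (FluctV N) θ.τ9.M)
    (tnew : SeqOfRecord F θ.ν θ.τ9.M (gOfRecord₁₃ F N θ.toStage13Params p) p.K 1 → Sect2.TermValues (F.P p.K) (MatA N) (FluctV N) θ.τ9.M)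
    (EkN : SeqOfRecord F θ.ν θ.τ9.M (gOfRecord₁₃ F N θ.toStage13Params p) p.K 1 → ℝ)
    (s' : SeqOfRecord F θ.ν θ.τ9.M (gOfRecord₁₃ F N θ.toStage13Params p) p.K 1) (hΩ : s'.Ω 1 = Set.univ) (hΛ : s'.Λ 1 = Set.univ)
    (hnew : Step.LFNewTerms (sect2TowerOfRecord F N (FluctV N) p.K (settingOfRecord₁₃ F N θ.toStage13Params p) (θ.rzAt p s') s' (tnew s'))
      (settingOfRecord₁₃ F N θ.toStage13Params p).lf (settingOfRecord₁₃ F N θ.toStage13Params p).βc 0)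
    (hanE : ∀ (X : (Sect2.domSys (F.P p.K) θ.τ9.M 1).Dom) (z : Site (F.P p.K) 1) (g : ℝ), 0 ≤ g → g ≤ (settingOfRecord₁₃ F N θ.toStage13Params p).lf.γ →
      AnalyticOnNhd ℂ ((tnew s').E 1 X z g)
        ((sect2TowerOfRecord F N (FluctV N) p.K (settingOfRecord₁₃ F N θ.toStage13Params p) (θ.rzAt p s') s' (tnew s')).space 1 X
          ((settingOfRecord₁₃ F N θ.toStage13Params p).lf.alpha0 ((settingOfRecord₁₃ F N θ.toStage13Params p).flow.g 1))
          ((settingOfRecord₁₃ F N θ.toStage13Params p).lf.alpha1 ((settingOfRecord₁₃ F N θ.toStage13Params p).flow.g 1))))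
    (hanR : ∀ X : (Sect2.domSys (F.P p.K) θ.τ9.M 1).Dom,
      AnalyticOnNhd ℂ ((tnew s').R 1 X)
        ((sect2TowerOfRecord F N (FluctV N) p.K (settingOfRecord₁₃ F N θ.toStage13Params p) (θ.rzAt p s') s' (tnew s')).space 1 X
          ((settingOfRecord₁₃ F N θ.toStage13Params p).lf.alpha0 ((settingOfRecord₁₃ F N θ.toStage13Params p).flow.g 1))
          ((settingOfRecord₁₃ F N θ.toStage13Params p).lf.alpha1 ((settingOfRecord₁₃ F N θ.toStage13Params p).flow.g 1))))
    (hanB : ∀ (X : (Sect2.domSys (F.P p.K) θ.τ9.M 1).Dom) (a : SFluct (F.P p.K) (FluctV N)),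
      AnalyticOnNhd ℂ (fun φ => (tnew s').B 1 X φ a)
        ((sect2TowerOfRecord F N (FluctV N) p.K (settingOfRecord₁₃ F N θ.toStage13Params p) (θ.rzAt p s') s' (tnew s')).spaceB 1 X))
    (hT : slotsTOfRecord F N θ.ν θ.τ9 (EOfRecord₁₃ F N θ.toStage13Params) (wOfRecord₉ F N θ.toStage9Params) θ.ppSel p (gOfRecord₁₃ F N θ.toStage13Params p) 1 s' = 0 ∨
      ∀ᵐ V' ∂fieldMeasure (F.P p.K) 1 (SU N),
        chiSeqOfRecord F N θ.ν θ.τ9.M (gOfRecord₁₃ F N θ.toStage13Params p) p.K 1 s' V' ≠ 0 →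
          transportOfRecord F N p.K 0 (fun U =>
              chiPrime (sect3DataOfRecord F N θ.ν θ.τ9.M p (gOfRecord₁₃ F N θ.toStage13Params p) 0 s'.init) (avOfRecord F N p.K)
                  (2 * deltaOfRecord θ.ν (gOfRecord₁₃ F N θ.toStage13Params p) 0 θ.A₁) (Finset.univ : Finset (Iχ F θ.ν p (gOfRecord₁₃ F N θ.toStage13Params p) 0)) U V' *
                (∑ S : Finset (Iχ F θ.ν p (gOfRecord₁₃ F N θ.toStage13Params p) 0), θ.ζ p (gOfRecord₁₃ F N θ.toStage13Params p) 0 s'.init ∅ ∅ (∅, S) U V') *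
                rhoZeroOfRecord F N p.K (gOfRecord₁₃ F N θ.toStage13Params p 0) (EOfRecord₁₃ F N θ.toStage13Params p) U) V' =
            (WtOfRecord₁₃H F N θ p s').ζ 0 ∅ (baseCfg 1 V') * (WtOfRecord₁₃H F N θ p s').w 0 Set.univ ∅ ∅ (baseCfg 1 V') *
              Real.exp ((sect2ActionDataOfRecord F N (FluctV N) p.K (settingOfRecord₁₃ F N θ.toStage13Params p) (θ.rzAt p s') s' (tnew s') (fun _ => ∅, fun _ => 0) (EkN s')).action23 1
                (UbgOfRecord₁₃CoP F N θ.toStage13Params p 1 s' (fun j => ((baseCfg (V := FluctV N) 1 V') j).1)))) :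
    PresentChildObligations θ p 0 t tnew EkN s' :=
  (presentChildObligations_zero_iff t tnew EkN s').2 (firstStepClausesAt_top_of_identity θ p hM s' hΩ hΛ (tnew s') (EkN s') hnew hanE hanR hanB hT)

end FirstStep

end Summit.QuantumFields.YangMills.Theorems.BalabanUVNodesN11TopChildO3AtRecord13

end
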